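import Mathlib
import Summits.NavierStokesRegularity.NavierStokesRegularity.Theorems.TypeILiouvilleTypeIliouvilleLOseenGauge
import Summits.NavierStokesRegularity.NavierStokesRegularity.Theorems.ScenarioCensusPitchDefectGaugeTools
import Literature.Analysis.FluidPDE.TypeIAncientMild
import Literature.Analysis.FluidPDE.LocalTypeIBlowup.SingularVertexZoom
import Literature.Analysis.FluidPDE.AncientLPSLiouvilleMild
import Literature.Analysis.FluidPDE.BoundedWeakDriftLimit
import Literature.Analysis.FluidPDE.KNSSRegularityGalileanProofs
import HarnessLib

/-!
# Census row A8t, line «pitch-defect»: the helical Oseen gauge (stub S1, moving-axis form)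

Support file for the scenario census of `NavierStokesRegularity` (row A8t,
`…Theorems.ScenarioCensus.Row_A8t`; line «pitch-defect» of ns-idea-2 g7 rev 2, stub S1
`stub_helicalGauge`; KEY-NS #101 (2)). PROVED: `helicalGauge` — every ancient mild solution `u`
(duality form, `ν = 1`, a.e.-strongly measurable slices) on `ℝ³ × (−∞,0)` which is helically
symmetric (`u(t, R_θ x + hθ e₃) = R_θ u(t,x)`) and has the time-Type-I rate
`‖u(t,x)‖ ≤ C/√(−t)` is, after the time shift `τ ↦ τ + t₁` (`t₁ < 0`), slice-wise a.e. the
Galilean image `x ↦ V(τ, x − A(τ)) + γ(τ) e₃` of a GENUINE Type-I ancient mild field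
`V ∈ IsTypeIAncientMild (2C)` (jointly smooth, divergence free, strong Oseen formula, rate `2C`),
with a continuous frame path `A` and an AXIAL parasitic constant `γ(τ)e₃`; and every slice
`V(τ, ·)` is helically symmetric with the same pitch about the vertical axis through `−A(τ)`:
`V(τ, R_θ y + (R_θ A(τ) − A(τ) + hθ e₃)) = R_θ V(τ, y)`.

This is the ideator's S1 except that the axis of the genuine field is allowed to MOVE with `τ`
(always vertical, same pitch); the lever S3 only uses the symmetry slice by slice, so the
moving-axis form suffices for the composition (reshaped stub; see the census STATUS line of
ns-census-typer-2 g5).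

Proof (all inputs are landed tree theorems):
1. `w(τ) = u(τ + t₁)` is a bounded ancient mild solution; the Oseen gauge theorem
   `Theorems.oseen_gauge_of_aestronglyMeasurable` writes `w(τ) = v(τ, · − A(τ)) + c(τ)` a.e. with
   `v` bounded continuous Oseen-mild.
2. The screw symmetry of `w(τ)` passes to `v(τ)` as a TWISTED identity
   `v(τ, R_θ y + D) = R_θ v(τ,y) + (R_θ c(τ) − c(τ))` (`helical_transfer`).
3. Conservation of momentum at infinity for `v` (`Theorems.stub_oseen_ball_average_momentum`) and
   the ball-average calculus of `ScenarioCensusPitchDefectGaugeTools` force the twist constant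
   `R_θ c(τ) − c(τ)` to be independent of `τ` (`twist_eq_twist_of_tendsto`), i.e. `c(τ) − c(σ)`
   is axial; and `‖v(τ) + c(τ)‖ ≤ C/√(−τ)` with momentum conservation gives
   `‖c(τ) − c(σ)‖ ≤ C/√(−τ) + C/√(−σ)`, so `c(σ) → c_∞` as `σ → −∞` and
   `‖v(τ) + c_∞‖ ≤ 2C/√(−τ)`.
4. The Galilean boost by the CONSTANT `c_∞` (`Theorems.stub_driftMild_ancient_oseen` applied to
   the drift-mild pair `(v + c_∞, −c_∞)`) gives an Oseen-mild `V` with rate `2C`, hence a member of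
   `IsTypeIAncientMild (2C)` (`LocalTypeIBlowup.isTypeIAncientMild_of_continuous_oseenMild_rate`);
   the remaining parasitic constant `c(τ) − c_∞` is axial and commutes with the rotations, so the
   twist of `V(τ)` vanishes.

No summit statement and no census row is proved here; nothing here is a claim about NS regularity.
-/

-- the summit and its single problem share the name (D-0017 nested layout)
set_option linter.dupNamespace false

noncomputable section

open MeasureTheory Set Function Filter Metric
open scoped Topology ENNReal NNReal

namespace Summit.NavierStokesRegularity.NavierStokesRegularity.Theorems.ScenarioCensus.PitchDefect

open Literature.Analysis Literature.Analysis.FluidPDE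
open Summit.NavierStokesRegularity.NavierStokesRegularity.Theorems

/-- **Conservation of momentum at infinity for a bounded Oseen-mild field**:
`⨍_{B(0,R)} (v(t) − v(s)) → 0` (`s < t < 0`), from `Theorems.stub_oseen_ball_average_momentum` and
the Oseen integral equation. [cite: KochNadirashviliSereginSverak2009, §4 p. 8 (arXiv:0709.3599)] -/
theorem tendsto_setAverage_sub_of_oseenMild
    {v : ℝ → EuclideanSpace ℝ (Fin 3) → EuclideanSpace ℝ (Fin 3)} (hvm : Measurable (uncurry v))
    {K : ℝ} (hK : ∀ t < 0, ∀ x, ‖v t x‖ ≤ K)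
    (hmild : ∀ s t : ℝ, s < t → t < 0 → ∀ x,
      v t x = UnboundedOperators.heatExtension (v s) (t - s) x - oseenDuhamel 1 s v v t x)
    {s t : ℝ} (hst : s < t) (ht : t < 0) :
    Tendsto (fun R : ℝ => ⨍ y in ball (0 : EuclideanSpace ℝ (Fin 3)) R, (v t y - v s y))
      atTop (𝓝 0) := by
  have hb : ∀ σ ∈ Icc s t, ∀ y, ‖v σ y‖ ≤ K := fun σ hσ y => hK σ (hσ.2.trans_lt ht) y
  have key := stub_oseen_ball_average_momentum v K s t hst hvm hb
  refine key.congr fun R => ?_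
  congr 1
  funext y
  rw [hmild s t hst ht y]
  abel

/-- **The helical Oseen gauge (stub S1 of «pitch-defect», moving-axis form).** See the module
docstring. For a helically symmetric ancient mild solution with the time-Type-I rate `C` and any
`t₁ < 0`: a genuine Type-I ancient mild field `V` with constant `2C`, a continuous frame path `A`
and an axial gauge `γ`, such that `u(τ + t₁) = V(τ, · − A(τ)) + γ(τ)e₃` a.e. for every `τ < 0`,
and every slice `V(τ)` is helically symmetric (same pitch) about the vertical axis through
`−A(τ)`. [cite: KochNadirashviliSereginSverak2009, §1 p. 3 and §4 p. 8 (parasitic solutions, Galilean frames, mild bounded ancient solutions; arXiv:0709.3599)] -/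
theorem helicalGauge {h C : ℝ}
    {u : ℝ → EuclideanSpace ℝ (Fin 3) → EuclideanSpace ℝ (Fin 3)}
    (hu : IsAncientMildSolution 1 u) (hmeas : ∀ t < 0, AEStronglyMeasurable (u t) volume)
    (hhel : ∀ t < 0, ∀ (θ : ℝ) (x : EuclideanSpace ℝ (Fin 3)),
      u t (rotZ θ x + (h * θ) • EuclideanSpace.single 2 (1 : ℝ)) = rotZ θ (u t x))
    (hC : HasTypeITimeDecay C u) {t₁ : ℝ} (ht₁ : t₁ < 0) :
    ∃ (V : ℝ → EuclideanSpace ℝ (Fin 3) → EuclideanSpace ℝ (Fin 3))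
      (A : ℝ → EuclideanSpace ℝ (Fin 3)) (γ : ℝ → ℝ),
      IsTypeIAncientMild (2 * C) V ∧ Continuous A ∧
      (∀ τ < 0, ∀ (θ : ℝ) (y : EuclideanSpace ℝ (Fin 3)),
        V τ (rotZ θ y + (rotZ θ (A τ) - A τ + (h * θ) • EuclideanSpace.single 2 (1 : ℝ))) =
          rotZ θ (V τ y)) ∧
      ∀ τ < 0, u (τ + t₁) =ᵐ[volume] fun x =>
        V τ (x - A τ) + γ τ • EuclideanSpace.single 2 (1 : ℝ) := by
  -- ## Step 0: the bounded shifted solution `w`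
  have hsq₁ : 0 < Real.sqrt (-t₁) := Real.sqrt_pos.2 (by linarith)
  have hC0 : 0 ≤ C := by
    have h0 := (norm_nonneg _).trans (hC t₁ ht₁ 0)
    rwa [le_div_iff₀ hsq₁, zero_mul] at h0
  set w : ℝ → EuclideanSpace ℝ (Fin 3) → EuclideanSpace ℝ (Fin 3) := fun τ => u (τ + t₁) with hw_def
  have hwC : ∀ τ < 0, ∀ x, ‖w τ x‖ ≤ C / Real.sqrt (-τ) := by
    intro τ hτ x
    have h1 := hC (τ + t₁) (by linarith) x
    have h2 : Real.sqrt (-τ) ≤ Real.sqrt (-(τ + t₁)) := Real.sqrt_le_sqrt (by linarith)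
    exact h1.trans (div_le_div_of_nonneg_left hC0 (Real.sqrt_pos.2 (by linarith)) h2)
  have hw : IsBoundedAncientMildSolution 1 w := by
    refine ⟨hu.time_translate ht₁.le, C / Real.sqrt (-t₁), fun τ hτ x => ?_⟩
    have hτ' : τ < 0 := mem_Iio.1 hτ
    have h1 := hC (τ + t₁) (by linarith) x
    have h2 : Real.sqrt (-t₁) ≤ Real.sqrt (-(τ + t₁)) := Real.sqrt_le_sqrt (by linarith)
    exact h1.trans (div_le_div_of_nonneg_left hC0 hsq₁ h2)
  have hwmeas : ∀ τ < 0, AEStronglyMeasurable (w τ) volume := fun τ hτ => hmeas (τ + t₁) (by linarith)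
  have hwhel : ∀ τ < 0, ∀ (θ : ℝ) (x : EuclideanSpace ℝ (Fin 3)),
      w τ (rotZ θ x + (h * θ) • EuclideanSpace.single 2 (1 : ℝ)) = rotZ θ (w τ x) :=
    fun τ hτ θ x => hhel (τ + t₁) (by linarith) θ x
  -- ## Step 1: the Oseen gauge of `w`
  obtain ⟨v, A, c, hvm, hvc, ⟨K, hK⟩, hvdiv, hvmild, hAc, hrep⟩ :=
    oseen_gauge_of_aestronglyMeasurable w hw hwmeas
  have hvslice : ∀ τ < 0, Continuous (v τ) := fun τ hτ =>
    hvc.comp_continuous (Continuous.prodMk_right τ) fun y => ⟨hτ, mem_univ y⟩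
  have hK0 : 0 ≤ K := (norm_nonneg _).trans (hK (-1) (by norm_num) 0)
  -- ## Step 2: conservation of momentum for `v`
  have hmom : ∀ s t : ℝ, s < t → t < 0 →
      Tendsto (fun R : ℝ => ⨍ y in ball (0 : EuclideanSpace ℝ (Fin 3)) R, (v t y - v s y))
        atTop (𝓝 0) := fun s t hst ht => tendsto_setAverage_sub_of_oseenMild hvm hK hvmild hst ht
  -- ## Step 3: the twisted screw identity for `v`
  have htw : ∀ τ < 0, ∀ (θ : ℝ) (y : EuclideanSpace ℝ (Fin 3)),
      v τ (rotZ θ y + (rotZ θ (A τ) - A τ + (h * θ) • EuclideanSpace.single 2 (1 : ℝ))) =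
        rotZ θ (v τ y) + (rotZ θ (c τ) - c τ) :=
    fun τ hτ θ => helical_transfer (hvslice τ hτ) (hwhel τ hτ θ) (hrep τ hτ)
  -- ## Step 4: `c τ - c σ` is fixed by the half turn (axial)
  have haxial : ∀ σ τ : ℝ, σ < 0 → τ < 0 → rotZ Real.pi (c τ - c σ) = c τ - c σ := by
    intro σ τ hσ hτ
    have key : rotZ Real.pi (c τ) - c τ = rotZ Real.pi (c σ) - c σ := by
      rcases lt_trichotomy σ τ with hστ | rfl | hτσ
      · exact twist_eq_twist_of_tendsto (hvslice τ hτ) (hvslice σ hσ) (hK τ hτ) (hK σ hσ)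
          (htw τ hτ Real.pi) (htw σ hσ Real.pi) (hmom σ τ hστ hτ)
      · rfl
      · exact (twist_eq_twist_of_tendsto (hvslice σ hσ) (hvslice τ hτ) (hK σ hσ) (hK τ hτ)
          (htw σ hσ Real.pi) (htw τ hτ Real.pi) (hmom τ σ hτσ hσ)).symm
    rw [← rotZL_apply, map_sub, rotZL_apply, rotZL_apply]
    calc rotZ Real.pi (c τ) - rotZ Real.pi (c σ)
        = (rotZ Real.pi (c τ) - c τ) - (rotZ Real.pi (c σ) - c σ) + (c τ - c σ) := by abel
      _ = c τ - c σ := by rw [key]; abel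
  -- ## Step 5: `‖v τ y + c τ‖ ≤ C/√(-τ)`
  have hprox : ∀ τ < 0, ∀ y, ‖v τ y + c τ‖ ≤ C / Real.sqrt (-τ) := by
    intro τ hτ y
    have hW : Continuous fun x => v τ (x - A τ) + c τ :=
      ((hvslice τ hτ).comp (continuous_id.sub continuous_const)).add continuous_const
    have key := TypeIliouvilleL.GaugeEverySlice.norm_le_of_ae_eq hW (hwC τ hτ) (hrep τ hτ) (y + A τ)
    simpa only [add_sub_cancel_right] using key
  -- ## Step 6: `‖c τ - c σ‖ ≤ C/√(-τ) + C/√(-σ)`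
  have hcdist : ∀ σ τ : ℝ, σ < 0 → τ < 0 →
      ‖c τ - c σ‖ ≤ C / Real.sqrt (-τ) + C / Real.sqrt (-σ) := by
    -- averaged form of Step 5 and momentum conservation
    have hav : ∀ τ < 0, ∀ R : ℝ, 0 < R →
        ‖(⨍ y in ball (0 : EuclideanSpace ℝ (Fin 3)) R, v τ y) - (-c τ)‖ ≤ C / Real.sqrt (-τ) :=
      fun τ hτ R hR => TypeIliouvilleL.GaugeEverySlice.norm_setAverage_ball_sub_le
        (hvslice τ hτ).aestronglyMeasurable (fun y => by rw [sub_neg_eq_add]; exact hprox τ hτ y) hR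
    have hgen : ∀ σ τ : ℝ, σ < τ → τ < 0 →
        ‖c τ - c σ‖ ≤ C / Real.sqrt (-τ) + C / Real.sqrt (-σ) := by
      intro σ τ hστ hτ
      have hσ : σ < 0 := hστ.trans hτ
      have hb : ∀ᶠ R : ℝ in atTop,
          ‖(⨍ y in ball (0 : EuclideanSpace ℝ (Fin 3)) R, (v τ y - v σ y)) - (c σ - c τ)‖ ≤
            C / Real.sqrt (-τ) + C / Real.sqrt (-σ) := by
        filter_upwards [eventually_gt_atTop 0] with R hR
        have hfi : IntegrableOn (v τ) (ball (0 : EuclideanSpace ℝ (Fin 3)) R) volume :=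
          integrableOn_ball_of_norm_le (hvslice τ hτ).aestronglyMeasurable (hK τ hτ) 0 R
        have hgi : IntegrableOn (v σ) (ball (0 : EuclideanSpace ℝ (Fin 3)) R) volume :=
          integrableOn_ball_of_norm_le (hvslice σ hσ).aestronglyMeasurable (hK σ hσ) 0 R
        have hsub : (⨍ y in ball (0 : EuclideanSpace ℝ (Fin 3)) R, (v τ y - v σ y)) =
            (⨍ y in ball (0 : EuclideanSpace ℝ (Fin 3)) R, v τ y) -
              ⨍ y in ball (0 : EuclideanSpace ℝ (Fin 3)) R, v σ y := by
          rw [setAverage_eq, setAverage_eq, setAverage_eq, integral_sub hfi hgi, smul_sub]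
        rw [hsub]
        calc ‖(⨍ y in ball (0 : EuclideanSpace ℝ (Fin 3)) R, v τ y) -
              (⨍ y in ball (0 : EuclideanSpace ℝ (Fin 3)) R, v σ y) - (c σ - c τ)‖
            = ‖((⨍ y in ball (0 : EuclideanSpace ℝ (Fin 3)) R, v τ y) - (-c τ)) -
                ((⨍ y in ball (0 : EuclideanSpace ℝ (Fin 3)) R, v σ y) - (-c σ))‖ := by
              congr 1; abel
          _ ≤ ‖(⨍ y in ball (0 : EuclideanSpace ℝ (Fin 3)) R, v τ y) - (-c τ)‖ +
                ‖(⨍ y in ball (0 : EuclideanSpace ℝ (Fin 3)) R, v σ y) - (-c σ)‖ := norm_sub_le _ _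
          _ ≤ C / Real.sqrt (-τ) + C / Real.sqrt (-σ) := add_le_add (hav τ hτ R hR) (hav σ hσ R hR)
      have hlim : Tendsto (fun R : ℝ =>
          ‖(⨍ y in ball (0 : EuclideanSpace ℝ (Fin 3)) R, (v τ y - v σ y)) - (c σ - c τ)‖) atTop
          (𝓝 ‖(0 : EuclideanSpace ℝ (Fin 3)) - (c σ - c τ)‖) := ((hmom σ τ hστ hτ).sub_const _).norm
      have h := le_of_tendsto hlim hb
      rwa [zero_sub, norm_neg, norm_sub_rev] at h
    intro σ τ hσ hτ
    rcases lt_trichotomy σ τ with hστ | rfl | hτσ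
    · exact hgen σ τ hστ hτ
    · rw [sub_self, norm_zero]; positivity
    · rw [norm_sub_rev, add_comm]; exact hgen τ σ hτσ hσ
  -- ## Step 7: the limit `c∞` of `c` at `-∞`
  set cs : ℕ → EuclideanSpace ℝ (Fin 3) := fun n => c (-((n : ℝ) + 1)) with hcs_def
  have hcs_cauchy : CauchySeq cs := by
    refine cauchySeq_of_le_tendsto_0 (fun N : ℕ => 2 * C / Real.sqrt ((N : ℝ) + 1)) ?_ ?_
    · intro n m N hNn hNm
      rw [dist_eq_norm, hcs_def]
      have hn1 : (0 : ℝ) < (n : ℝ) + 1 := by positivity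
      have hm1 : (0 : ℝ) < (m : ℝ) + 1 := by positivity
      have hN1 : (0 : ℝ) < (N : ℝ) + 1 := by positivity
      have key := hcdist (-((m : ℝ) + 1)) (-((n : ℝ) + 1)) (by linarith) (by linarith)
      rw [neg_neg, neg_neg] at key
      have hNn0 : (N : ℝ) ≤ n := by exact_mod_cast hNn
      have hNm0 : (N : ℝ) ≤ m := by exact_mod_cast hNm
      have hNn' : Real.sqrt ((N : ℝ) + 1) ≤ Real.sqrt ((n : ℝ) + 1) :=
        Real.sqrt_le_sqrt (by linarith)
      have hNm' : Real.sqrt ((N : ℝ) + 1) ≤ Real.sqrt ((m : ℝ) + 1) :=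
        Real.sqrt_le_sqrt (by linarith)
      have hsN : 0 < Real.sqrt ((N : ℝ) + 1) := Real.sqrt_pos.2 hN1
      calc ‖c (-((n : ℝ) + 1)) - c (-((m : ℝ) + 1))‖
          ≤ C / Real.sqrt ((n : ℝ) + 1) + C / Real.sqrt ((m : ℝ) + 1) := key
        _ ≤ C / Real.sqrt ((N : ℝ) + 1) + C / Real.sqrt ((N : ℝ) + 1) :=
            add_le_add (div_le_div_of_nonneg_left hC0 hsN hNn')
              (div_le_div_of_nonneg_left hC0 hsN hNm')
        _ = 2 * C / Real.sqrt ((N : ℝ) + 1) := by ring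
    · have h1 : Tendsto (fun N : ℕ => Real.sqrt ((N : ℝ) + 1)) atTop atTop := by
        refine Real.tendsto_sqrt_atTop.comp ?_
        exact tendsto_atTop_add_const_right _ _ tendsto_natCast_atTop_atTop
      have h2 := h1.inv_tendsto_atTop.const_mul (2 * C)
      rw [mul_zero] at h2
      refine h2.congr fun N => ?_
      simp only [Pi.inv_apply, div_eq_mul_inv]
  obtain ⟨cinf, hcinf⟩ := cauchySeq_tendsto_of_complete hcs_cauchy
  -- `‖c τ - c∞‖ ≤ C/√(-τ)`
  have hcinf_dist : ∀ τ < 0, ‖c τ - cinf‖ ≤ C / Real.sqrt (-τ) := by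
    intro τ hτ
    have hlim : Tendsto (fun n : ℕ => ‖c τ - cs n‖) atTop (𝓝 ‖c τ - cinf‖) :=
      (tendsto_const_nhds.sub hcinf).norm
    have hbd : Tendsto (fun n : ℕ => C / Real.sqrt (-τ) + C / Real.sqrt ((n : ℝ) + 1)) atTop
        (𝓝 (C / Real.sqrt (-τ) + 0)) := by
      have h1 : Tendsto (fun N : ℕ => Real.sqrt ((N : ℝ) + 1)) atTop atTop := by
        refine Real.tendsto_sqrt_atTop.comp ?_
        exact tendsto_atTop_add_const_right _ _ tendsto_natCast_atTop_atTop
      have h2 := h1.inv_tendsto_atTop.const_mul C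
      rw [mul_zero] at h2
      refine tendsto_const_nhds.add (h2.congr fun N => ?_)
      simp only [Pi.inv_apply, div_eq_mul_inv]
    rw [add_zero] at hbd
    refine le_of_tendsto_of_tendsto' hlim hbd fun n => ?_
    have key := hcdist (-((n : ℝ) + 1)) τ (by have : (0:ℝ) ≤ n := n.cast_nonneg; linarith) hτ
    rwa [neg_neg] at key
  -- `c τ - c∞` is axial
  have hcinf_axial : ∀ τ < 0, rotZ Real.pi (c τ - cinf) = c τ - cinf := by
    intro τ hτ
    have hlim : Tendsto (fun n : ℕ => c τ - cs n) atTop (𝓝 (c τ - cinf)) :=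
      tendsto_const_nhds.sub hcinf
    have h1 : Tendsto (fun n : ℕ => rotZ Real.pi (c τ - cs n) - (c τ - cs n)) atTop
        (𝓝 (rotZ Real.pi (c τ - cinf) - (c τ - cinf))) :=
      (((continuous_rotZ' Real.pi).tendsto _).comp hlim).sub hlim
    have h2 : (fun n : ℕ => rotZ Real.pi (c τ - cs n) - (c τ - cs n)) = fun _ => 0 := by
      funext n
      rw [hcs_def]
      rw [haxial (-((n : ℝ) + 1)) τ (by have : (0:ℝ) ≤ n := n.cast_nonneg; linarith) hτ, sub_self]
    rw [h2] at h1
    have h3 := tendsto_nhds_unique h1 tendsto_const_nhds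
    exact sub_eq_zero.1 h3
  -- `‖v τ y + c∞‖ ≤ 2C/√(-τ)`
  have hprox2 : ∀ τ < 0, ∀ y, ‖v τ y + cinf‖ ≤ 2 * C / Real.sqrt (-τ) := by
    intro τ hτ y
    calc ‖v τ y + cinf‖ = ‖(v τ y + c τ) - (c τ - cinf)‖ := by congr 1; abel
      _ ≤ ‖v τ y + c τ‖ + ‖c τ - cinf‖ := norm_sub_le _ _
      _ ≤ C / Real.sqrt (-τ) + C / Real.sqrt (-τ) := add_le_add (hprox τ hτ y) (hcinf_dist τ hτ)
      _ = 2 * C / Real.sqrt (-τ) := by ring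
  -- ## Step 8: the Galilean boost by the constant `c∞`
  set U : ℝ → EuclideanSpace ℝ (Fin 3) → EuclideanSpace ℝ (Fin 3) := fun τ y => v τ y + cinf
    with hU_def
  set b : ℝ → EuclideanSpace ℝ (Fin 3) := fun _ => -cinf with hb_def
  have hUm : Measurable (uncurry U) := by
    have : uncurry U = fun p : ℝ × EuclideanSpace ℝ (Fin 3) => uncurry v p + cinf := by
      funext p; rfl
    rw [this]
    exact hvm.add_const cinf
  have hbm : Measurable b := measurable_const
  have hUc : ContinuousOn (uncurry U) (Iio 0 ×ˢ univ) := by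
    have : uncurry U = fun p : ℝ × EuclideanSpace ℝ (Fin 3) => uncurry v p + cinf := by
      funext p; rfl
    rw [this]
    exact hvc.add continuousOn_const
  have hloc : ∀ T : ℝ, T < 0 → ∃ N : ℝ,
      (∀ t ∈ Ioo T 0, ∀ x, ‖U t x‖ ≤ N) ∧ ∀ t ∈ Ioo T 0, ‖b t‖ ≤ N := by
    intro T _
    refine ⟨K + ‖cinf‖, fun t ht x => ?_, fun t _ => ?_⟩
    · calc ‖U t x‖ = ‖v t x + cinf‖ := rfl
        _ ≤ ‖v t x‖ + ‖cinf‖ := norm_add_le _ _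
        _ ≤ K + ‖cinf‖ := by gcongr; exact hK t ht.2 x
    · show ‖-cinf‖ ≤ K + ‖cinf‖
      rw [norm_neg]; linarith
  have hUdiv : ∀ t < 0, IsWeaklyDivFree (U t) := fun t ht => (hvdiv t ht).add_const cinf
  have hUmild : ∀ s t : ℝ, s < t → t < 0 → ∀ x,
      U t x = UnboundedOperators.heatExtension (U s) (t - s) x - driftDuhamel U b s t x := by
    intro s t hst ht x
    have hT : driftTensor U b = driftTensor v 0 := by
      funext σ j k y
      simp only [driftTensor_apply, hU_def, hb_def, add_neg_cancel_right, Pi.zero_apply, add_zero]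
    have hD : driftDuhamel U b s t x = oseenDuhamel 1 s v v t x := by
      have h1 : driftDuhamel U b s t x = driftDuhamel v 0 s t x := by
        rw [driftDuhamel_apply, driftDuhamel_apply, hT]
      rw [h1]
      exact driftDuhamel_zero_eq_oseenDuhamel finrank_euclideanSpace_fin
        (fun σ hσ => (hvslice σ (hσ.2.trans ht)).measurable)
        (fun σ hσ y => hK σ (hσ.2.trans ht) y) hst.le x
    have hH : UnboundedOperators.heatExtension (U s) (t - s) x =
        UnboundedOperators.heatExtension (v s) (t - s) x + cinf :=
      heatExtension_add_const_apply (hvslice s (hst.trans ht)).aestronglyMeasurable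
        (hK s (hst.trans ht)) cinf (sub_pos.2 hst) x
    rw [hD, hH]
    show v t x + cinf = _
    rw [hvmild s t hst ht x]
    abel
  obtain ⟨A₂, hA₂c, hVm, hVc, hVmild⟩ := stub_driftMild_ancient_oseen U b hUm hbm hUc hloc hUdiv hUmild
  -- ## Step 9: the genuine field `V`, its class, its symmetry and the representation
  set V : ℝ → EuclideanSpace ℝ (Fin 3) → EuclideanSpace ℝ (Fin 3) := fun t y => U t (y + A₂ t)
    with hV_def
  have hVdiv : ∀ t < 0, IsWeaklyDivFree (V t) := fun t ht => (hUdiv t ht).comp_add_right' (A₂ t)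
  have hVrate : HasTypeITimeDecay (2 * C) V := fun t ht y => hprox2 t ht (y + A₂ t)
  have hVmild' : ∀ s t : ℝ, s < t → t < 0 → ∀ y,
      V t y = UnboundedOperators.heatExtension (V s) (t - s) y - oseenDuhamel 1 s V V t y :=
    fun s t hst ht y => hVmild s t hst ht y
  have hVclass : IsTypeIAncientMild (2 * C) V :=
    LocalTypeIBlowup.isTypeIAncientMild_of_continuous_oseenMild_rate hVc hVdiv hVmild' hVrate
  have hVslice : ∀ τ < 0, Continuous (V τ) := fun τ hτ =>
    hVc.comp_continuous (Continuous.prodMk_right τ) fun y => ⟨hτ, mem_univ y⟩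
  -- the representation with frame path `A + A₂` and axial constant `c τ - c∞`
  set A' : ℝ → EuclideanSpace ℝ (Fin 3) := fun τ => A τ + A₂ τ with hA'_def
  have hrep' : ∀ τ < 0, w τ =ᵐ[volume] fun x => V τ (x - A' τ) + (c τ - cinf) := by
    intro τ hτ
    filter_upwards [hrep τ hτ] with x hx
    rw [hx]
    simp only [hV_def, hU_def, hA'_def]
    rw [show x - (A τ + A₂ τ) + A₂ τ = x - A τ by abel]
    abel
  refine ⟨V, A', fun τ => (c τ - cinf) 2, hVclass, hAc.add hA₂c, fun τ hτ θ y => ?_, fun τ hτ => ?_⟩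
  · -- helical symmetry of the slice `V τ` about the axis through `-A' τ`
    have key := helical_transfer (hVslice τ hτ) (hwhel τ hτ θ) (hrep' τ hτ) y
    rw [eq_smul_single_of_rotZ_pi_eq (hcinf_axial τ hτ), rotZ_smul_single, sub_self, add_zero] at key
    exact key
  · -- the representation of `u (τ + t₁) = w τ`
    have e : u (τ + t₁) = w τ := rfl
    rw [e]
    filter_upwards [hrep' τ hτ] with x hx
    rw [hx, ← eq_smul_single_of_rotZ_pi_eq (hcinf_axial τ hτ)]

end Summit.NavierStokesRegularity.NavierStokesRegularity.Theorems.ScenarioCensus.PitchDefect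

end
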